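import Literature.Barriers.CriticalPhenomena.PlaquetteWalkHoleRootThinBoxTable
import HarnessLib

/-!
# Barrier catalogue (SAWScalingLimit): THE THIN TOP — the door above the root edge and the top pocket above `rootE`, by
the row mirror; a hole one row below the top wall

Assembly leaf by ROW MIRROR (no new mechanism, no new definition) of `PlaquetteWalkHoleRootThinBoxCells` (the door below the
root edge) and `PlaquetteWalkHoleRootThinBoxTable` (the bottom pocket below `rootE`: two `θ`-corners in the root plaquette),
with the transport of `PlaquetteWalkHoleRootStructuralKill` (`rowMirrorDom`, `ΩG.mirrorFar`, `mirrorFar_wound`,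
`kindsIn_eq_coCorner_of_mirrorFar_corner`) and the thin TOP side of `PlaquetteWalkHoleRootThinSide` (hole, `K_N1`, the cell
above `farNW` absent ⇒ the OVER route is empty). Setting as in the parents; `rootN w = (w.1, w.2 + 1)`, `holeN = (w.1 − 1, w.2 + 1)`.

* §1 (every domain) ★★★★ `ΩG.WE_eq_excursionWinding_of_holeColumnN_door`: the column strictly ABOVE `holeN` shut and `holeN` or
  `rootN` absent ⇒ NO wound walk; `vertexFunctional_printed_eq_zero_of_holeColumnN_door` (`VF ≡ 0`); ★★★★
  `ΩG.kindsIn_root_eq_coCorner_of_wound_thinPocketNE`: column above `holeN` shut, the cell above `rootN` and the pocket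
  `(w.1 + 1, w.2 + 1)` absent ⇒ every wound walk carries two `(π − θ)`-corner arcs in `w` ⇒ `w₂`-marked
  (`ΩG.not_W2FreeOff_of_wound_thinPocketNE`).
* §2 thin-top tools with abstract under witnesses: `vertexFunctional_printed_eq_zero_of_thinN_of_under_empty`,
  `vertexFunctional_printed_pi_div_three_eq_zero_of_thinN_of_w2_killed`, `im_vertexFunctional_printed_neg_of_thinN_of_w1free`
  (`Im VF < 0` on `(π/3, 2π/3]`).
* §3 boxes: ALL boxes — `lawL_box_holeColumnN_door_eq_zero` (the whole column above the hole removed with `holeN` or `rootN` ⇒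
  `VF ≡ 0`); the THIN TOP BOX (`h.2 + 2 = n`, hole one row below the top wall; `2 ≤ h.1 ≤ m − 3`): the cell above the hole or
  above the root plaquette ⇒ `VF ≡ 0` (`thinTopBox_holeN_…`, `thinTopBox_rootN_…`); the top pocket `(h.1 + 2, n − 1)` ⇒
  `VF(π/3) = 0` EXACTLY and `Im VF < 0` on `(π/3, 2π/3]` (`thinTopBox_pocketNE_…`; `h.2 ≥ 2`) — the mirror image of the
  bottom pocket's isolated zero at `2π/3` (`thinBox_pocketSE_…`).

Not in print; venture lane «pcv-sawmu», seat b-step0 gen 27.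

References: A. Glazman, I. Manolescu, arXiv:1708.00395v3, §1 (Fig. 1, Fig. 2, the remark after eq. (1)), §2.1, §4.2 (lattice
symmetries) and Lemma 2.1 [GlazmanManolescu2019]; A. Glazman, Electron. Commun. Probab. 20 (2015) no. 86, Lemma 3.1, proof pp. 6–7
[Glazman2015WeightedSAW]; R. Courant, H. Robbins, *What is Mathematics?* (1941/1958), Ch. V Appendix §2 (the even–odd rule)
[CourantRobbins1958].
-/

noncomputable section

open Set Function Complex

namespace Literature.Probability.RandomPlanarGeometry.SAW.YangBaxter

open Real
open Literature.Barriers.CriticalPhenomena.PlaquetteWalk (mirrorRowFace)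

namespace ΩG

variable {D : Set Face} {w : Face}

/-- The reflection on a cell, in coordinates. [cite: GlazmanManolescu2019, §4.2 (lattice symmetries)] -/
private theorem mirrorRowFace_mkTT (w : Face) (x y : ℤ) : mirrorRowFace w.2 ((x, y) : Face) = (x, 2 * w.2 - y) := by
  simp [mirrorRowFace]

/-! ## §1 The door above the root edge; the top pocket above `rootE` -/

/-- ★★★★ **DOOR ABOVE THE ROOT EDGE SHUT ⇒ NO WOUND WALK** (row mirror of `WE_eq_excursionWinding_of_holeColumn_door`): the column
strictly above `holeN = (w.1 − 1, w.2 + 1)` shut and `holeN` or `rootN` absent ⇒ every class-`B2a` walk at the far cell is unwound.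
[cite: GlazmanManolescu2019, Lemma 2.1 (statement, "in the form given in [Gl]"), §4.2 (lattice symmetries)]
[cite: Glazman2015WeightedSAW, Lemma 3.1 (proof, pp. 6–7)] [cite: CourantRobbins1958, Ch. V Appendix §2 (the even–odd rule)] -/
theorem WE_eq_excursionWinding_of_holeColumnN_door (hcol : ∀ y : ℤ, w.2 + 2 ≤ y → ((w.1 - 1, y) : Face) ∉ D)
    (hdoor : ((w.1 - 1, w.2 + 1) : Face) ∉ D ∨ rootN w ∉ D)
    (ω : ΩG D (w.side .W) (farW w)) (hr : RootedFace D (w.side .W) (farW w)) (h : ω.IsB2a) (θ : ℝ) :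
    ω.WE (fun _ => θ) = excursionWinding θ ω.2.firstSideG (ω.z1 hr h) ω.1 := by
  by_contra hW
  have hr' := rootedFace_rowMirrorDom w hr
  have h' := ω.mirrorFar_isB2a hr h
  have hcol' : ∀ y : ℤ, y ≤ w.2 - 2 → ((w.1 - 1, y) : Face) ∉ rowMirrorDom w D := by
    intro y hy
    rw [mem_rowMirrorDom, mirrorRowFace_mkTT]
    exact hcol (2 * w.2 - y) (by omega)
  have hdoor' : ((w.1 - 1, w.2 - 1) : Face) ∉ rowMirrorDom w D ∨ rootS w ∉ rowMirrorDom w D := by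
    rcases hdoor with hd | hd
    · left; rw [mem_rowMirrorDom, mirrorRowFace_mkTT, show 2 * w.2 - (w.2 - 1) = w.2 + 1 by ring]; exact hd
    · right; rw [mem_rowMirrorDom, mirrorRowFace_rootS]; exact hd
  exact absurd (WE_eq_excursionWinding_of_holeColumn_door hcol' hdoor' ω.mirrorFar hr' h' (π - θ)) (ω.mirrorFar_wound hr h hW)

/-- Both route masses vanish identically. [cite: GlazmanManolescu2019, Lemma 2.1 (statement, "in the form given in [Gl]")] -/
theorem sum_routeMassW_eq_zero_of_holeColumnN_door [Finite D] (hcol : ∀ y : ℤ, w.2 + 2 ≤ y → ((w.1 - 1, y) : Face) ∉ D)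
    (hdoor : ((w.1 - 1, w.2 + 1) : Face) ∉ D ∨ rootN w ∉ D)
    (hr : RootedFace D (w.side .W) (farW w)) (s : Side) (θ : ℝ) :
    ∑ ω ∈ setB2a D (w.side .W) (farW w), routeMassW θ hr s ω = 0 := by
  classical
  refine Finset.sum_eq_zero fun ω _ => ?_
  unfold routeMassW
  split_ifs with h1 h2
  · exact absurd (WE_eq_excursionWinding_of_holeColumnN_door hcol hdoor ω hr h1 θ) h2.2
  · rfl
  · rfl

/-- ★★★★ **THIN TOP + THE POCKET ABOVE `rootE` ABSENT ⇒ EVERY WOUND WALK CARRIES TWO `(π − θ)`-CORNER ARCS IN THE ROOT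
PLAQUETTE** (row mirror of `kindsIn_root_eq_of_wound_thinPocketSE`): hole absent, the column strictly above `holeN` shut, the
cell `(w.1, w.2 + 2)` above `rootN` absent and the north-eastern pocket `(w.1 + 1, w.2 + 1)` absent.
[cite: GlazmanManolescu2019, §1 (Fig. 1; θ ↔ π − θ exchanges the corner kinds), §4.2, Lemma 2.1]
[cite: Glazman2015WeightedSAW, Lemma 3.1 (proof, pp. 6–7)] [cite: CourantRobbins1958, Ch. V Appendix §2 (the even–odd rule)] -/
theorem kindsIn_root_eq_coCorner_of_wound_thinPocketNE (hh : holeFaceW w ∉ D)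
    (hcol : ∀ y : ℤ, w.2 + 2 ≤ y → ((w.1 - 1, y) : Face) ∉ D)
    (hNN : ((w.1, w.2 + 2) : Face) ∉ D) (hP : ((w.1 + 1, w.2 + 1) : Face) ∉ D)
    (ω : ΩG D (w.side .W) (farW w)) (hr : RootedFace D (w.side .W) (farW w)) (h : ω.IsB2a) {θ : ℝ}
    (hW : ω.WE (fun _ => θ) ≠ excursionWinding θ ω.2.firstSideG (ω.z1 hr h) ω.1) :
    ω.2.kindsIn w = [.coCorner, .coCorner] := by
  have hr' := rootedFace_rowMirrorDom w hr
  have h' := ω.mirrorFar_isB2a hr h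
  have hh' : holeFaceW w ∉ rowMirrorDom w D := by rwa [mem_rowMirrorDom, mirrorRowFace_holeFaceW]
  have hcol' : ∀ y : ℤ, y ≤ w.2 - 2 → ((w.1 - 1, y) : Face) ∉ rowMirrorDom w D := by
    intro y hy
    rw [mem_rowMirrorDom, mirrorRowFace_mkTT]
    exact hcol (2 * w.2 - y) (by omega)
  have hSS' : ((w.1, w.2 - 2) : Face) ∉ rowMirrorDom w D := by
    rw [mem_rowMirrorDom, mirrorRowFace_mkTT, show 2 * w.2 - (w.2 - 2) = w.2 + 2 by ring]; exact hNN
  have hP' : ((w.1 + 1, w.2 - 1) : Face) ∉ rowMirrorDom w D := by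
    rw [mem_rowMirrorDom, mirrorRowFace_mkTT, show 2 * w.2 - (w.2 - 1) = w.2 + 1 by ring]; exact hP
  have hk := kindsIn_root_eq_of_wound_thinPocketSE hh' hcol' hSS' hP' ω.mirrorFar hr' h' (ω.mirrorFar_wound hr h hW)
  have hk2 := ω.kindsIn_eq_coCorner_of_mirrorFar_corner hk
  rwa [mirrorRowFace_self] at hk2

/-- ★★★★ Hence **no wound walk is `w₂`-free off the far cell**: the under route (and the empty over route) is `w₂`-KILLED
by the top pocket. [cite: GlazmanManolescu2019, §1 (the paragraph of Fig. 2: «if θ = π/3, then w₂ = 0»), Lemma 2.1]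
[cite: Glazman2015WeightedSAW, Lemma 3.1 (proof, pp. 6–7)] -/
theorem not_W2FreeOff_of_wound_thinPocketNE (hh : holeFaceW w ∉ D)
    (hcol : ∀ y : ℤ, w.2 + 2 ≤ y → ((w.1 - 1, y) : Face) ∉ D)
    (hNN : ((w.1, w.2 + 2) : Face) ∉ D) (hP : ((w.1 + 1, w.2 + 1) : Face) ∉ D)
    (ω : ΩG D (w.side .W) (farW w)) (hr : RootedFace D (w.side .W) (farW w)) (h : ω.IsB2a) {θ : ℝ}
    (hW : ω.WE (fun _ => θ) ≠ excursionWinding θ ω.2.firstSideG (ω.z1 hr h) ω.1) : ¬ω.2.W2FreeOff (farW w) := by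
  have hk := kindsIn_root_eq_coCorner_of_wound_thinPocketNE hh hcol hNN hP ω hr h hW
  intro hfree
  have hmem : w ∈ ω.2.facesVisited := by
    by_contra hn
    rw [YBWalk.kindsIn_eq_nil hn] at hk
    exact List.cons_ne_nil _ _ hk.symm
  exact hfree _ hmem (root_ne_farW w) hk

/-- The under route is `w₂`-killed (LAW L's first universal kill statement, at every angle).
[cite: GlazmanManolescu2019, §1 (the paragraph of Fig. 2), Lemma 2.1] [cite: Glazman2015WeightedSAW, Lemma 3.1 (proof, pp. 6–7)] -/
theorem under_w2_killed_of_thinPocketNE (hh : holeFaceW w ∉ D)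
    (hcol : ∀ y : ℤ, w.2 + 2 ≤ y → ((w.1 - 1, y) : Face) ∉ D)
    (hNN : ((w.1, w.2 + 2) : Face) ∉ D) (hP : ((w.1 + 1, w.2 + 1) : Face) ∉ D)
    (hr : RootedFace D (w.side .W) (farW w)) (θ : ℝ) :
    ∀ (ω : ΩG D (w.side .W) (farW w)) (h : ω.IsB2a), ω.2.firstSideG = .S →
      ω.WE (fun _ => θ) ≠ excursionWinding θ ω.2.firstSideG (ω.z1 hr h) ω.1 → ¬ω.2.W2FreeOff (farW w) :=
  fun ω h _ hW => not_W2FreeOff_of_wound_thinPocketNE hh hcol hNN hP ω hr h hW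

end ΩG

end Literature.Probability.RandomPlanarGeometry.SAW.YangBaxter

namespace Literature.Barriers.CriticalPhenomena.PlaquetteWalk

open Literature.Probability.RandomPlanarGeometry.SAW.YangBaxter
open Real Complex

/-! ## §2 Thin-top tools -/

section ThinTopTools

variable {Dl : List Face} {w : Face}

/-- ★★★★ **DOOR ABOVE THE ROOT EDGE SHUT ⇒ `VF ≡ 0`.** [cite: GlazmanManolescu2019, Lemma 2.1 (statement, "in the form given in [Gl]")]
[cite: Glazman2015WeightedSAW, Lemma 3.1 (proof, pp. 6–7)] -/
theorem vertexFunctional_printed_eq_zero_of_holeColumnN_door {θ : ℝ} (hθ : θ ∈ Set.Icc (π / 3) (2 * π / 3))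
    (hf : farW w ∈ Dl) (hh : holeFaceW w ∉ dom Dl)
    (hcol : ∀ y : ℤ, w.2 + 2 ≤ y → ((w.1 - 1, y) : Face) ∉ dom Dl)
    (hdoor : ((w.1 - 1, w.2 + 1) : Face) ∉ dom Dl ∨ rootN w ∉ dom Dl) :
    vertexFunctional (printedWeights θ) tFiveEighths (ybCoeff θ) Dl (w.side .W) (farW w) = 0 := by
  have hr : RootedFace (dom Dl) (w.side .W) (farW w) := ⟨hf, fun hb => hh (by rw [root_faces_W] at hb; exact hb.1)⟩
  rw [vertexFunctional_printed_farCellW_eq hθ Dl w hf hh hr,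
    ΩG.sum_routeMassW_eq_zero_of_holeColumnN_door hcol hdoor hr .S θ,
    ΩG.sum_routeMassW_eq_zero_of_holeColumnN_door hcol hdoor hr .N θ]
  simp

/-- **Thin top + under route EMPTY ⇒ `VF ≡ 0`** (hole, `K_N1`, the cell above `farNW` absent, no western door above; no wound
under-walk). [cite: GlazmanManolescu2019, Lemma 2.1 (statement, "in the form given in [Gl]")] [cite: Glazman2015WeightedSAW, Lemma 3.1 (proof, pp. 6–7)] -/
theorem vertexFunctional_printed_eq_zero_of_thinN_of_under_empty {θ : ℝ} (hθ : θ ∈ Set.Icc (π / 3) (2 * π / 3))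
    (hf : farW w ∈ Dl) (hh : holeFaceW w ∉ dom Dl) (hKN : killNW w ∉ dom Dl) (hT : ((w.1 - 2, w.2 + 2) : Face) ∉ dom Dl)
    (hcolN : ∀ y : ℤ, w.2 + 3 ≤ y → (w.1 - 3, y) ∉ dom Dl ∨ (w.1 - 2, y) ∉ dom Dl)
    (hr : RootedFace (dom Dl) (w.side .W) (farW w))
    (hS : ∀ (ω : ΩG (dom Dl) (w.side .W) (farW w)) (h : ω.IsB2a), ω.2.firstSideG = .S →
      ω.WE (fun _ => θ) = excursionWinding θ ω.2.firstSideG (ω.z1 hr h) ω.1) :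
    vertexFunctional (printedWeights θ) tFiveEighths (ybCoeff θ) Dl (w.side .W) (farW w) = 0 := by
  classical
  have hSum : ∑ ω ∈ ΩG.setB2a (dom Dl) (w.side .W) (farW w), ΩG.routeMassW θ hr .S ω = 0 := by
    refine Finset.sum_eq_zero fun ω _ => ?_
    unfold ΩG.routeMassW
    split_ifs with h1 h2
    · exact absurd (hS ω h1 h2.1) h2.2
    · rfl
    · rfl
  rw [vertexFunctional_printed_farCellW_eq hθ Dl w hf hh hr, ΩG.sum_routeMassW_N_eq_zero_of_thinN hh hKN hcolN hT hr θ, hSum]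
  simp

/-- **Thin top + under route `w₂`-killed ⇒ `VF(π/3) = 0`.** [cite: GlazmanManolescu2019, §1 (the paragraph of Fig. 2), Lemma 2.1]
[cite: Glazman2015WeightedSAW, Lemma 3.1 (proof, pp. 6–7)] -/
theorem vertexFunctional_printed_pi_div_three_eq_zero_of_thinN_of_under_w2_killed
    (hf : farW w ∈ Dl) (hh : holeFaceW w ∉ dom Dl) (hKN : killNW w ∉ dom Dl) (hT : ((w.1 - 2, w.2 + 2) : Face) ∉ dom Dl)
    (hcolN : ∀ y : ℤ, w.2 + 3 ≤ y → (w.1 - 3, y) ∉ dom Dl ∨ (w.1 - 2, y) ∉ dom Dl)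
    (hr : RootedFace (dom Dl) (w.side .W) (farW w))
    (hK : ∀ (ω : ΩG (dom Dl) (w.side .W) (farW w)) (h : ω.IsB2a), ω.2.firstSideG = .S →
      ω.WE (fun _ => π / 3) ≠ excursionWinding (π / 3) ω.2.firstSideG (ω.z1 hr h) ω.1 → ¬ω.2.W2FreeOff (farW w)) :
    vertexFunctional (printedWeights (π / 3)) tFiveEighths (ybCoeff (π / 3)) Dl (w.side .W) (farW w) = 0 := by
  have hθ : (π / 3 : ℝ) ∈ Set.Icc (π / 3) (2 * π / 3) := ⟨le_rfl, by linarith [Real.pi_pos]⟩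
  rw [vertexFunctional_printed_farCellW_eq hθ Dl w hf hh hr, ΩG.sum_routeMassW_N_eq_zero_of_thinN hh hKN hcolN hT hr _,
    ΩG.sum_routeMassW_pi_div_three_eq_zero_of_killed hr .S hK]
  simp

/-- **Thin top + ONE `w₁`-free wound under-walk at every angle ⇒ `Im VF(θ) < 0` for `θ ∈ (π/3, 2π/3]`.**
[cite: GlazmanManolescu2019, Lemma 2.1, §1 eq. (1) and the remark after it] [cite: Glazman2015WeightedSAW, Lemma 3.1 (proof, pp. 6–7)] -/
theorem im_vertexFunctional_printed_neg_of_thinN_of_w1free {θ : ℝ} (hθ : θ ∈ Set.Ioc (π / 3) (2 * π / 3))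
    (hf : farW w ∈ Dl) (hh : holeFaceW w ∉ dom Dl) (hKN : killNW w ∉ dom Dl) (hT : ((w.1 - 2, w.2 + 2) : Face) ∉ dom Dl)
    (hcolN : ∀ y : ℤ, w.2 + 3 ≤ y → (w.1 - 3, y) ∉ dom Dl ∨ (w.1 - 2, y) ∉ dom Dl)
    (hr : RootedFace (dom Dl) (w.side .W) (farW w))
    (hU1 : ∀ θ' : ℝ, ∃ (ω : ΩG (dom Dl) (w.side .W) (farW w)) (h : ω.IsB2a), ω.2.firstSideG = .S ∧
      ω.WE (fun _ => θ') ≠ excursionWinding θ' ω.2.firstSideG (ω.z1 hr h) ω.1 ∧ ω.2.W1FreeOff (farW w)) :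
    (vertexFunctional (printedWeights θ) tFiveEighths (ybCoeff θ) Dl (w.side .W) (farW w)).im < 0 := by
  have hθ' : θ ∈ Set.Icc (π / 3) (2 * π / 3) := ⟨hθ.1.le, hθ.2⟩
  rcases eq_or_lt_of_le hθ.2 with e2 | h2
  · rw [e2]
    exact im_vertexFunctional_printed_farCellW_two_pi_div_three_neg_of_over_killed Dl w hf hh hr
      (ΩG.over_killed_both_of_thinN hh hKN hcolN hT hr _).2 (hU1 _)
  have hθo : θ ∈ Set.Ioo (π / 3) (2 * π / 3) := ⟨hθ.1, h2⟩
  rw [vertexFunctional_printed_farCellW_im_eq hθ' Dl w hf hh hr, ΩG.sum_routeMassW_N_eq_zero_of_thinN hh hKN hcolN hT hr θ,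
    zero_sub, mul_neg, neg_lt_zero]
  obtain ⟨ω, h, hSd, hW, -⟩ := hU1 θ
  exact mul_pos (weightV_pos_of_mem_Ioo ⟨by linarith [hθo.1, Real.pi_pos], by linarith [hθo.2, Real.pi_pos]⟩)
    (ΩG.sum_routeMassW_pos_of_wound hr .S hθo ⟨ω, h, hSd, hW⟩)

end ThinTopTools

/-! ## §3 Boxes: the column above the hole; the thin top box -/

section ThinTopBoxes

variable {m n : ℕ} {S : List Face} {h : Face}

/-- ★★★★ **ALL BOXES: the column above the hole shut up to the wall and the door `holeN | rootN` broken ⇒ `VF ≡ 0`**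
(`S ∋ h` misses the far cell, contains every `(h.1, y)` with `h.2 + 2 ≤ y ≤ n − 1`, and contains `(h.1, h.2 + 1)` or
`(h.1 + 1, h.2 + 1)`). [cite: GlazmanManolescu2019, Lemma 2.1 (statement, "in the form given in [Gl]"), §4.2]
[cite: Glazman2015WeightedSAW, Lemma 3.1 (proof, pp. 6–7)] [cite: CourantRobbins1958, Ch. V Appendix §2 (the even–odd rule)] -/
theorem lawL_box_holeColumnN_door_eq_zero (hW : 1 ≤ h.1) (hE : h.1 + 2 ≤ m) (hS : 0 ≤ h.2) (hN : h.2 + 1 ≤ n) (hh : h ∈ S)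
    (hfS : ((h.1 - 1, h.2) : Face) ∉ S) (hcolS : ∀ y : ℤ, h.2 + 2 ≤ y → y + 1 ≤ n → ((h.1, y) : Face) ∈ S)
    (hdoor : ((h.1, h.2 + 1) : Face) ∈ S ∨ ((h.1 + 1, h.2 + 1) : Face) ∈ S) {θ : ℝ}
    (hθ : θ ∈ Set.Icc (π / 3) (2 * π / 3)) :
    vertexFunctional (printedWeights θ) tFiveEighths (ybCoeff θ) (boxMinus m n S) (Face.side (h.1 + 1, h.2) .W)
      (farW (h.1 + 1, h.2)) = 0 := by
  have hf := farW_hroot_mem_boxMinus_of_not_mem (m := m) (n := n) hW (by omega) hS hN hfS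
  refine vertexFunctional_printed_eq_zero_of_holeColumnN_door hθ hf ?_ (fun y hy hm => ?_) ?_
  · rw [holeFaceW_hroot]; exact not_mem_dom_boxMinus_of_mem hh
  · obtain ⟨hb, hs⟩ := mem_dom_boxMinus.1 hm
    simp only at hb hy
    have e : (((h.1 + 1, h.2) : Face).1 - 1, y) = ((h.1, y) : Face) := Prod.ext (by simp only; omega) rfl
    rw [e] at hs
    exact hs (hcolS y (by omega) (by omega))
  · rcases hdoor with hd | hd
    · left
      have e : ((((h.1 + 1, h.2) : Face).1 - 1, ((h.1 + 1, h.2) : Face).2 + 1) : Face) = (h.1, h.2 + 1) :=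
        Prod.ext (by simp only; omega) rfl
      rw [e]; exact not_mem_dom_boxMinus_of_mem hd
    · right
      have e : rootN ((h.1 + 1, h.2) : Face) = (h.1 + 1, h.2 + 1) := Prod.ext (by simp only [rootN]) rfl
      rw [e]; exact not_mem_dom_boxMinus_of_mem hd

/-- The thin-TOP hypotheses of a box with the hole one row below the top wall (`h.2 + 2 = n`), any `S ∋ h` missing the far cell.
[cite: GlazmanManolescu2019, §2.1 (finite domains of faces)] -/
theorem thinTopBox_hyps (hW : 2 ≤ h.1) (hE : h.1 + 2 ≤ m) (hS : 0 ≤ h.2) (hN : h.2 + 2 = n) (hh : h ∈ S)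
    (hfS : ((h.1 - 1, h.2) : Face) ∉ S) :
    farW ((h.1 + 1, h.2) : Face) ∈ boxMinus m n S ∧ holeFaceW ((h.1 + 1, h.2) : Face) ∉ dom (boxMinus m n S) ∧
      killNW ((h.1 + 1, h.2) : Face) ∉ dom (boxMinus m n S) ∧
      ((((h.1 + 1, h.2) : Face).1 - 2, ((h.1 + 1, h.2) : Face).2 + 2) : Face) ∉ dom (boxMinus m n S) ∧
      (∀ y : ℤ, ((h.1 + 1, h.2) : Face).2 + 3 ≤ y →
        ((((h.1 + 1, h.2) : Face).1 - 3, y) : Face) ∉ dom (boxMinus m n S) ∨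
          ((((h.1 + 1, h.2) : Face).1 - 2, y) : Face) ∉ dom (boxMinus m n S)) := by
  refine ⟨farW_hroot_mem_boxMinus_of_not_mem (by omega) (by omega) hS (by omega) hfS, ?_, ?_, ?_, fun y hy => ?_⟩
  · rw [holeFaceW_hroot]; exact not_mem_dom_boxMinus_of_mem hh
  · intro hm; have hb := (mem_dom_boxMinus.1 hm).1; simp only [killNW] at hb; omega
  · intro hm; have hb := (mem_dom_boxMinus.1 hm).1; simp only at hb; omega
  · left; intro hm; have hb := (mem_dom_boxMinus.1 hm).1; simp only at hb hy; omega

/-- ★★★★ **THIN TOP BOX, THE CELL ABOVE THE HOLE REMOVED ⇒ `VF ≡ 0`** (`h.2 + 2 = n`, cell `(h.1, n − 1)`).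
[cite: GlazmanManolescu2019, Lemma 2.1 (statement, "in the form given in [Gl]"), §4.2] [cite: Glazman2015WeightedSAW, Lemma 3.1 (proof, pp. 6–7)] -/
theorem thinTopBox_holeN_vertexFunctional_eq_zero (hW : 1 ≤ h.1) (hE : h.1 + 2 ≤ m) (hS : 0 ≤ h.2) (hN : h.2 + 2 = n)
    {θ : ℝ} (hθ : θ ∈ Set.Icc (π / 3) (2 * π / 3)) :
    vertexFunctional (printedWeights θ) tFiveEighths (ybCoeff θ) (boxMinus m n [h, (h.1, h.2 + 1)])
      (Face.side (h.1 + 1, h.2) .W) (farW (h.1 + 1, h.2)) = 0 := by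
  refine lawL_box_holeColumnN_door_eq_zero hW hE hS (by omega) (by simp) ?_ (fun y hy1 hy2 => by omega) (Or.inl (by simp)) hθ
  rw [List.mem_cons, List.mem_singleton, not_or]
  exact ⟨fun e => by have := (Prod.ext_iff.1 e).1; simp only at this; omega,
    fun e => by have := (Prod.ext_iff.1 e).1; simp only at this; omega⟩

/-- ★★★★ **THIN TOP BOX, THE CELL ABOVE THE ROOT PLAQUETTE REMOVED ⇒ `VF ≡ 0`** (`h.2 + 2 = n`, cell `(h.1 + 1, n − 1)`).
[cite: GlazmanManolescu2019, Lemma 2.1 (statement, "in the form given in [Gl]"), §4.2] [cite: Glazman2015WeightedSAW, Lemma 3.1 (proof, pp. 6–7)] -/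
theorem thinTopBox_rootN_vertexFunctional_eq_zero (hW : 1 ≤ h.1) (hE : h.1 + 2 ≤ m) (hS : 0 ≤ h.2) (hN : h.2 + 2 = n)
    {θ : ℝ} (hθ : θ ∈ Set.Icc (π / 3) (2 * π / 3)) :
    vertexFunctional (printedWeights θ) tFiveEighths (ybCoeff θ) (boxMinus m n [h, (h.1 + 1, h.2 + 1)])
      (Face.side (h.1 + 1, h.2) .W) (farW (h.1 + 1, h.2)) = 0 := by
  refine lawL_box_holeColumnN_door_eq_zero hW hE hS (by omega) (by simp) ?_ (fun y hy1 hy2 => by omega) (Or.inr (by simp)) hθ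
  rw [List.mem_cons, List.mem_singleton, not_or]
  exact ⟨fun e => by have := (Prod.ext_iff.1 e).1; simp only at this; omega,
    fun e => by have := (Prod.ext_iff.1 e).1; simp only at this; omega⟩

/-- ★★★★★ **THIN TOP BOX, THE TOP POCKET ABOVE `rootE` REMOVED ⇒ `VF(π/3) = 0` EXACTLY** (`h.2 + 2 = n`, `2 ≤ h.1 ≤ m − 3`, cell
`(h.1 + 2, n − 1)`): every wound walk carries two `(π − θ)`-corners in the root plaquette — the under route is `w₂`-KILLED, the
over route empty. The row mirror of `thinBox_pocketSE_vertexFunctional_two_pi_div_three_eq_zero`.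
[cite: GlazmanManolescu2019, §1 (the paragraph of Fig. 2), §2.1, §4.2, Lemma 2.1] [cite: Glazman2015WeightedSAW, Lemma 3.1 (proof, pp. 6–7)]
[cite: CourantRobbins1958, Ch. V Appendix §2 (the even–odd rule)] -/
theorem thinTopBox_pocketNE_vertexFunctional_pi_div_three_eq_zero (hW : 2 ≤ h.1) (hE : h.1 + 3 ≤ m) (hS : 0 ≤ h.2)
    (hN : h.2 + 2 = n) :
    vertexFunctional (printedWeights (π / 3)) tFiveEighths (ybCoeff (π / 3))
      (boxMinus m n [h, (h.1 + 2, h.2 + 1)]) (Face.side (h.1 + 1, h.2) .W) (farW (h.1 + 1, h.2)) = 0 := by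
  obtain ⟨hf, hh, hKN, hT, hcolN⟩ := thinTopBox_hyps (m := m) (n := n) (S := [h, (h.1 + 2, h.2 + 1)]) hW (by omega) hS hN
    (by simp) (by
      rw [List.mem_cons, List.mem_singleton, not_or]
      exact ⟨fun e => by have := (Prod.ext_iff.1 e).1; simp only at this; omega,
        fun e => by have := (Prod.ext_iff.1 e).1; simp only at this; omega⟩)
  have hr := rootedFace_hroot_boxMinus_of_mem hf (by simp)
  refine vertexFunctional_printed_pi_div_three_eq_zero_of_thinN_of_under_w2_killed hf hh hKN hT hcolN hr ?_
  refine ΩG.under_w2_killed_of_thinPocketNE hh (fun y hy hm => ?_) (fun hm => ?_) ?_ hr _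
  · have hb := (mem_dom_boxMinus.1 hm).1; simp only at hb hy; omega
  · have hb := (mem_dom_boxMinus.1 hm).1; simp only at hb; omega
  · have e : ((((h.1 + 1, h.2) : Face).1 + 1, ((h.1 + 1, h.2) : Face).2 + 1) : Face) = (h.1 + 2, h.2 + 1) :=
      Prod.ext (by simp only; omega) rfl
    rw [e]; exact not_mem_dom_boxMinus_of_mem (by simp)

/-- The `w₁`-free under block sits in the thin top box minus the top pocket. [cite: GlazmanManolescu2019, §2.1 (finite domains of faces), §4.2 (translation invariance)] -/
theorem underBlockW_hroot_subset_thinTopBox_pocketNE (hW : 2 ≤ h.1) (hE : h.1 + 3 ≤ m) (hS : 2 ≤ h.2) (hN : h.2 + 2 = n) :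
    ∀ c ∈ underBlockW (h.1 + 1, h.2), c ∈ boxMinus m n [h, (h.1 + 2, h.2 + 1)] :=
  block_hroot_subset_boxMinus_of_bounds (m := m) (n := n) (h := h) underBlockW42 1 5 0 3 5 3 (by decide)
    (by omega) (by omega) (by omega) (by omega) ⟨by omega, by omega⟩

/-- … while `Im VF(θ) < 0` — so `VF(θ) ≠ 0` — for every `θ ∈ (π/3, 2π/3]` (`h.2 ≥ 2`: the `w₁`-free under block survives):
the mirror image of the bottom pocket's isolated zero at `2π/3`. [cite: GlazmanManolescu2019, §1 (remark after eq. (1)), §2.1, §4.2, Lemma 2.1]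
[cite: Glazman2015WeightedSAW, Lemma 3.1 (proof, pp. 6–7)] -/
theorem thinTopBox_pocketNE_im_neg_of_gt (hW : 2 ≤ h.1) (hE : h.1 + 3 ≤ m) (hS : 2 ≤ h.2) (hN : h.2 + 2 = n) {θ : ℝ}
    (hθ : θ ∈ Set.Ioc (π / 3) (2 * π / 3)) :
    (vertexFunctional (printedWeights θ) tFiveEighths (ybCoeff θ) (boxMinus m n [h, (h.1 + 2, h.2 + 1)])
      (Face.side (h.1 + 1, h.2) .W) (farW (h.1 + 1, h.2))).im < 0 := by
  obtain ⟨hf, hh, hKN, hT, hcolN⟩ := thinTopBox_hyps (m := m) (n := n) (S := [h, (h.1 + 2, h.2 + 1)]) hW (by omega)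
    (by omega) hN (by simp) (by
      rw [List.mem_cons, List.mem_singleton, not_or]
      exact ⟨fun e => by have := (Prod.ext_iff.1 e).1; simp only at this; omega,
        fun e => by have := (Prod.ext_iff.1 e).1; simp only at this; omega⟩)
  have hr := rootedFace_hroot_boxMinus_of_mem hf (by simp)
  exact im_vertexFunctional_printed_neg_of_thinN_of_w1free hθ hf hh hKN hT hcolN hr
    fun θ' => exists_under_w1free_of_underBlockW (underBlockW_hroot_subset_thinTopBox_pocketNE hW hE hS hN) hr θ'

end ThinTopBoxes

end Literature.Barriers.CriticalPhenomena.PlaquetteWalk
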